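import Mathlib
import HarnessLib
import Summits.ResolutionOfSingularities.ResolutionOfSingularities.Theorems.WildQuotientsWildQuotientResolutionS1aKillTouch
import Summits.ResolutionOfSingularities.ResolutionOfSingularities.Theorems.WildQuotientsWildQuotientResolutionS1aWinsOfSeqRule

/-!
# S1a — `WinsOfTouchRule p` PROVED: the registered stub ⇐ `KillTouchReach p ∧ AuxTopWithinReach p` (lead-1 g9 reshape of the K stub)

[OURS · L1 W4.5c · lead-1 g9; the `Theses`-cone wrapper of `…S1aKillTouch`] — NOT statements of the manuscript; counted 0; AI-level work, weaker than
expert review. Crux stmt-ResolutionOfSingularities-17941, line `s1a-logminvertex` v8, registered stub `stub_winningStrategy`.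

* ★★ `winningStrategy_of_killTouchReach_of_auxTopWithinReach : p.Prime → KillTouchReach p → AuxTopWithinReach p → FrameWins.WinningStrategy p` —
  `wins_of_killTouchOrAuxSeq` with `P := Reachable (initial)` (measure `(jInf, n, nIrrComp badLocus)`);
* `WinsOfTouchRule p` and `winsOfTouchRule : WinsOfTouchRule p`; `winsOfSeqRule_of_winsOfTouchRule` (the v7 residual follows: `KillFamilyReach ⇒ KillTouchReach`);
* `cyclicQuotientFourfolds_of_door_of_killTouchReach_of_auxTopWithinReach` (door + the two research statements ⇒ the sub-crux).
-/

set_option linter.dupNamespace false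

noncomputable section

open CategoryTheory Limits AlgebraicGeometry TopologicalSpace
open Literature.AlgebraicGeometry.Resolution Literature.AlgebraicGeometry.RelativeSpec
open Summit.ResolutionOfSingularities.ResolutionOfSingularities.Theorems.WildQuotientResolution.S1
open Summit.ResolutionOfSingularities.ResolutionOfSingularities.Theorems.WildQuotientResolution.S1.NodeAtlas
open Summit.ResolutionOfSingularities.ResolutionOfSingularities.Theorems.WildQuotientResolution.S1.GameFrame
open Summit.ResolutionOfSingularities.ResolutionOfSingularities.Theorems.WildQuotientResolution.S1.KillFamily

namespace Summit.ResolutionOfSingularities.ResolutionOfSingularities.Theorems.WildQuotientResolution.S1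

/-- ★★ **THE TERMINATION CRUX FROM THE TOUCH FORM**: `KillTouchReach p ∧ AuxTopWithinReach p ⇒ WinningStrategy p` (`p` prime), by the lexicographic
induction `wins_of_killTouchOrAuxSeq` on `(jInf, n, nIrrComp badLocus)` with the invariant class `P := Reachable (initial)`. [OURS · L1 W4.5c] -/
theorem winningStrategy_of_killTouchReach_of_auxTopWithinReach {p : ℕ} (hp : p.Prime) (hK : KillTouchReach p) (hA : AuxTopWithinReach p) :
    FrameWins.WinningStrategy p := by
  intro k _ _ _ X' X₁ f q G _ _ ρ hG hfs hfft hfqc hX₁ _ hreg hqfin hqs hqet hq horb hdim hinj g₀ hg₀ _ h₀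
  haveI := hfft
  haveI := hfqc
  haveI := hqfin
  have HK := hK k X' X₁ f q G ρ hG hfs hfft hfqc hX₁ hreg hqfin hqs hqet hq horb hdim hinj g₀ hg₀ h₀
  have HA := hA k X' X₁ f q G ρ hG hfs hfft hfqc hX₁ hreg hqfin hqs hqet hq horb hdim hinj g₀ hg₀ h₀
  refine GameFrame.GModel.wins_of_killTouchOrAuxSeq hp hg₀ ((GameFrame.GModel.initial hq h₀).Reachable)
    (fun M M' 𝒦 d hR hadm hmv => GameFrame.GModel.Reachable.move 𝒦 d hR hadm hmv)
    (fun M _ => GameFrame.GModel.hasNoetherianBase_of_datum f M) (fun M _ => GameFrame.GModel.exists_nat_nu1_lt_of_datum f M)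
    (fun M _ => GameFrame.GModel.finite_irreducibleComponents_badLocus_of_datum f M)
    (fun M hR hT => ?_) (GameFrame.GModel.initial hq h₀) GameFrame.GModel.Reachable.refl
  by_cases hj : M.jInf = ⊥
  · exact Or.inl (HK M hR hT hj)
  · obtain ⟨n, hn⟩ := HA M hR hT hj
    exact Or.inr ⟨n, GameFrame.GModel.auxAltWithin_of_auxTopWithin hp hg₀ (fun M => GameFrame.GModel.hasNoetherianBase_of_datum f M) n M hn⟩

/-- **`WinsOfTouchRule p`**: the game side of the residual after the lead-1 g9 reshape of the K stub. [OURS · L1 W4.5c] -/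
def WinsOfTouchRule (p : ℕ) : Prop :=
  p.Prime → KillTouchReach p → AuxTopWithinReach p → FrameWins.WinningStrategy p

/-- ★★ **`WinsOfTouchRule p` HOLDS** for every `p`. [OURS · L1 W4.5c] -/
theorem winsOfTouchRule (p : ℕ) : WinsOfTouchRule p :=
  fun hp hK hA => winningStrategy_of_killTouchReach_of_auxTopWithinReach hp hK hA

/-- Nothing is lost: the v7 residual `WinsOfSeqRule p` follows from the touch form (`KillFamilyReach ⇒ KillTouchReach`). [OURS · L1 W4.5c] -/
theorem winsOfSeqRule_of_winsOfTouchRule {p : ℕ} (h : WinsOfTouchRule p) : WinsOfSeqRule p :=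
  fun hp hK hA => h hp (killTouchReach_of_killFamilyReach hp hK) hA

/-- **Door + the two research statements (touch form) ⇒ the sub-crux `CyclicQuotientFourfolds`.** [OURS · L1 W4.5c] -/
theorem cyclicQuotientFourfolds_of_door_of_killTouchReach_of_auxTopWithinReach (hD : FrameWins.DoorStatement)
    (hK : ∀ p : ℕ, p.Prime → KillTouchReach p) (hA : ∀ p : ℕ, p.Prime → AuxTopWithinReach p) :
    Summit.ResolutionOfSingularities.ResolutionOfSingularities.Theses.WildQuotients.CyclicQuotientFourfolds :=
  FrameWins.cyclicQuotientFourfolds_of_door_of_wins hD fun p hp _ =>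
    winningStrategy_of_killTouchReach_of_auxTopWithinReach hp (hK p hp) (hA p hp)

end Summit.ResolutionOfSingularities.ResolutionOfSingularities.Theorems.WildQuotientResolution.S1

end
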